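import Summits.Ventures.PercRepro.MSTightSingShapeA
import Summits.Ventures.PercRepro.MSTightUpDown

/-!
# Shape B of `SingCaseIResidue α`: a Case II configuration has an unsignable `r`-member

Dossier proofs/MINE1-theoremS.md, Addendum 59 (THEOREM (shape B)); HANDOFF §mine-1 gen 32 → 33,
step (K5). Shape B of the non-monotone Case I of `(F, u)` (`completion1 r F` tight) is shape A of
the complement family `G = F*` with `ū = univ ∖ u` a partnerless `r`-member of `G` (CASE II).
**Theorem** (`false_of_caseII`): a residue instance `(G, u)` with `r ∈ u`, a tight trace,
`completion0 r G` tight, `ū ∈ partr r G ∖ part0 r G`, `{r} ∉ G`, `univ.erase r ∉ G` is impossible —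
some `r`-member of `G` is neither A- nor C*-signable, against `Residue.hsig`. In coordinates:
`ū = (x̄, ȳ)`, `ȳ ∈ U ∖ U₀`, `u₁ = (N ∖ x̄, M ∖ ȳ) ∉ P` (so (i) `N ∖ x̄ ∉ L` or (ii) `M ∖ ȳ ∉ U`);
A-signability of an `r`-member `insert r t` gives `t ∖ ū ∈ Y`, C*-signability `t ∩ ū, u₁ ∖ t ∈ X`.
(4) `(x̄, M)` is partnerless, so by (ROW-a) every row `x ≠ x̄` is full; (5) in case (ii) a full row
`(x, M)`, `x ≠ x̄`, is unsignable; (6) in case (i) `(∅, M)` is unsignable if `x̄ ≠ ∅`, and if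
`x̄ = ∅` the fibre of row `∅` is all of `M − U₀`, the excess one forces `U₀ ∖ K^∅ = {M}`, and for
`e ∈ ȳ` the co-singleton member `(∅, M ∖ e)` is unsignable (C* would need `univ.erase r ∈ P`).
-/

namespace PercRepro.MSTight

open Finset
open scoped FinsetFamily

variable {α : Type*} [DecidableEq α] [Fintype α] {G : Finset (Finset α)} {r : α} {u : Finset α}

section CaseII

/-- A singleton of `M` is a difference of the completion (it is addable and some member of the
completion avoids it). -/
theorem singleton_mem_diffs_completion0_of_mem_cM (htw : ∀ a b, Twin G a b → a = b)
    (hcore : ∀ a, ∃ t ∈ G, a ∉ t) {e : α} (he : e ∈ cM r G) :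
    ({e} : Finset α) ∈ completion0 r G \\ completion0 r G := by
  have hadd : ClosedAdd (completion0 r G) (cls (completion0 r G) e) := mem_Rstar.1 (cM_subset_Rstar he)
  rw [cls_eq_singleton_of_twinFree (twinFree_completion0 htw hcore)] at hadd
  obtain ⟨t, ht, het⟩ := hcore e
  have ht' : t ∈ completion0 r G := by
    rcases (em (r ∈ t)) with hrt | hrt
    · have : insert r (t.erase r) = t := insert_erase hrt
      rw [← this]
      exact insert_mem_completion0_of_mem_proj (mem_proj.2 ⟨t, ht, rfl⟩)
    · exact mem_completion0.2 (Or.inl (mem_part0.2 ⟨ht, hrt⟩))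
  refine mem_diffs.2 ⟨t ∪ {e}, hadd t ht', t, ht', ?_⟩
  rw [union_sdiff_left]
  exact sdiff_eq_left.2 (disjoint_singleton_left.2 het)

/-- The co-singleton `M ∖ {e}` lies in `U` for every `e ∈ M`. -/
theorem cM_sdiff_singleton_mem_cU (htw : ∀ a b, Twin G a b → a = b) (hcore : ∀ a, ∃ t ∈ G, a ∉ t)
    {e : α} (he : e ∈ cM r G) : cM r G \ {e} ∈ cU r G := by
  refine mem_cU.2 ⟨sdiff_subset, ?_⟩
  rw [Finset.sdiff_sdiff_eq_self (singleton_subset_iff.2 he)]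
  exact singleton_mem_diffs_completion0_of_mem_cM htw hcore he

/-- `L` has a nonempty member: `N` is nonempty and covered by the trace. -/
theorem exists_nonempty_mem_cL (htw : ∀ a b, Twin G a b → a = b) (hcore : ∀ a, ∃ t ∈ G, a ∉ t)
    (hsupp : ∀ a, ∃ t ∈ G, a ∈ t) (hC : Tight (completion0 r G)) (hS : univ.erase r ∉ G) :
    ∃ x ∈ cL r G, x ≠ ∅ := by
  obtain ⟨a, ha⟩ := cN_nonempty htw hcore hC hS
  obtain ⟨t, ht, hat⟩ := hsupp a
  have haM : a ∉ cM r G := disjoint_left.1 disjoint_cN_cM ha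
  have har : a ≠ r := fun h => r_notMem_cN (r_mem_Rstar_completion0 htw hcore) (h ▸ ha)
  have hp : t.erase r ∈ proj r G := mem_proj.2 ⟨t, ht, rfl⟩
  refine ⟨t.erase r \ cM r G, sdiff_cM_mem_cL_of_mem_proj htw hcore hC hp, ?_⟩
  intro h
  have : a ∈ t.erase r \ cM r G := mem_sdiff.2 ⟨mem_erase.2 ⟨har, hat⟩, haM⟩
  rw [h] at this
  exact notMem_empty a this

/-- An A-signable `r`-member `insert r t` has `t ∖ ū ∈ Y` (`u ∋ r`, `r ∉ t`). -/
theorem sdiff_mem_diffsY_of_cells (hru : r ∈ u) {t : Finset α} (hrt : r ∉ t)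
    (hA : Cells (G \\ G) (insert r t) u) : t \ (univ \ u) ∈ diffsY r G := by
  obtain ⟨h1, -⟩ := hA
  have e : insert r t ∩ u = insert r (t \ (univ \ u)) := by
    ext a
    simp only [mem_inter, mem_insert, mem_sdiff, mem_univ, true_and, not_not]
    constructor
    · rintro ⟨h | h, hau⟩
      · exact Or.inl h
      · exact Or.inr ⟨h, hau⟩
    · rintro (rfl | ⟨hat, hau⟩)
      · exact ⟨Or.inl rfl, hru⟩
      · exact ⟨Or.inr hat, hau⟩
  rw [e] at h1
  exact mem_diffsY_iff.2 ⟨fun h => hrt (mem_sdiff.1 h).1, h1⟩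

/-- A C*-signable `r`-member `insert r t` has `t ∖ u₁ ∈ X` and `u₁ ∖ t ∈ X` (`u ∋ r`, `r ∉ t`). -/
theorem mem_diffsX_of_cells_compl (hru : r ∈ u) {t : Finset α} (hrt : r ∉ t)
    (hC : Cells (G \\ G) (insert r t) (univ \ u)) :
    t \ u.erase r ∈ diffsX r G ∧ u.erase r \ t ∈ diffsX r G := by
  obtain ⟨h1, h2⟩ := (cells_compl_iff_of_mem hru hrt).1 hC
  exact ⟨(mem_diffs_iff_mem_diffsX (fun h => hrt (mem_sdiff.1 h).1)).1 h1,
    (mem_diffs_iff_mem_diffsX (fun h => (mem_erase.1 (mem_sdiff.1 h).1).1 rfl)).1 h2⟩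

/-- `M ∖ yb ∈ Y` forces `yb ∈ U₀` (the fibre of row `∅` lies in `M − U₀`). -/
theorem mem_cU0_of_sdiff_mem_diffsY (htw : ∀ a b, Twin G a b → a = b)
    (hcore : ∀ a, ∃ t ∈ G, a ∉ t) (hC : Tight (completion0 r G)) {y : Finset α} (hy : y ⊆ cM r G)
    (h : cM r G \ y ∈ diffsY r G) : y ∈ cU0 r G := by
  have : cM r G \ y ∈ fibre (cM r G) (diffsY r G) ∅ := by
    refine mem_fibre.2 ⟨sdiff_subset, ?_⟩
    rwa [empty_union]
  have := fibre_diffsY_subset_complWithin htw hcore hC ∅ this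
  rwa [mem_complWithin_iff (fun _ hy => subset_cM_of_mem_cU0 hy) sdiff_subset,
    Finset.sdiff_sdiff_eq_self hy] at this

/-- **Shape B is impossible** (Addendum 59): a residue instance `(G, u)` with `r ∈ u`, a tight
trace, `completion0 r G` tight, `univ ∖ u ∈ partr r G ∖ part0 r G`, `{r} ∉ G` and
`univ.erase r ∉ G` has an `r`-member that is neither A- nor C*-signable. -/
theorem false_of_caseII (hR : Residue G u) (hP : Tight (proj r G)) (hC : Tight (completion0 r G))
    (hru : r ∈ u) (hū : univ \ u ∈ partr r G) (hū0 : univ \ u ∉ part0 r G)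
    (hr1 : ({r} : Finset α) ∉ G) (hS : univ.erase r ∉ G) : False := by
  have htw := hR.htf
  have hF := hR.hexc
  have hE := hR.hempty
  have hU := hR.huniv
  have hcore := hR.hcore
  have hsupp := hR.hsupp
  have hr : r ∈ Rstar (completion0 r G) := r_mem_Rstar_completion0 htw hcore
  have hrem : ¬ partr r G ⊆ part0 r G := fun h => hū0 (h hū)
  have hYdown : ∀ y ∈ diffsY r G, ∀ z ⊆ y, z ∈ diffsY r G := fun y hy z hz =>
    mem_diffsY_of_subset_of_genuine htw hF hE hU hcore hsupp hy hz
  have hūP : univ \ u ∈ proj r G := mem_proj_of_mem_partr hū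
  set xb := (univ \ u) \ cM r G with hxbdef
  set yb := (univ \ u) ∩ cM r G with hybdef
  have hxb : xb ∈ cL r G := sdiff_cM_mem_cL_of_mem_proj htw hcore hC hūP
  have hybU : yb ∈ cU r G := inter_cM_mem_cU_of_mem_proj htw hcore hC hūP
  have hybM : yb ⊆ cM r G := inter_subset_right
  have hyb0 : yb ∉ cU0 r G := by
    intro h
    apply hū0
    have := union_mem_part0 htw hcore hC hxb h
    rwa [sdiff_union_inter] at this
  -- an `r`-member `insert r t` with `M ∖ yb ⊆ t ∖ ū` is not A-signable (else `yb ∈ U₀`)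
  have hnotA : ∀ t ∈ partr r G, cM r G \ yb ⊆ t \ (univ \ u) → ¬ Cells (G \\ G) (insert r t) u := by
    intro t ht hsub hA
    have hY := sdiff_mem_diffsY_of_cells hru (mem_partr.1 ht).1 hA
    exact hyb0 (mem_cU0_of_sdiff_mem_diffsY htw hcore hC hybM (hYdown _ hY _ hsub))
  -- `u₁ = (N ∖ xb) ∪ (M ∖ yb)`
  have hu₁ : u.erase r = (cN r G \ xb) ∪ (cM r G \ yb) := by
    ext a
    constructor
    · intro h
      obtain ⟨har, hau⟩ := mem_erase.1 h
      have haū : a ∉ univ \ u := fun h' => (mem_sdiff.1 h').2 hau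
      rcases eq_or_mem_cN_or_mem_cM a with h' | h' | h'
      · exact absurd h' har
      · exact mem_union_left _ (mem_sdiff.2 ⟨h', fun h'' => haū (mem_sdiff.1 h'').1⟩)
      · exact mem_union_right _ (mem_sdiff.2 ⟨h', fun h'' => haū (mem_inter.1 h'').1⟩)
    · intro h
      rcases mem_union.1 h with h | h
      · obtain ⟨haN, haxb⟩ := mem_sdiff.1 h
        refine mem_erase.2 ⟨fun har => r_notMem_cN hr (har ▸ haN), ?_⟩
        by_contra hau
        exact haxb (mem_sdiff.2 ⟨mem_sdiff.2 ⟨mem_univ a, hau⟩, disjoint_left.1 disjoint_cN_cM haN⟩)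
      · obtain ⟨haM, hayb⟩ := mem_sdiff.1 h
        refine mem_erase.2 ⟨fun har => r_notMem_cM (har ▸ haM), ?_⟩
        by_contra hau
        exact hayb (mem_inter.2 ⟨mem_sdiff.2 ⟨mem_univ a, hau⟩, haM⟩)
  -- the `M`-part of `(x ∪ M) ∖ u₁` is `yb`, for every row `x`
  have hinteryb : ∀ x : Finset α, ((x ∪ cM r G) \ u.erase r) ∩ cM r G = yb := by
    intro x
    rw [hu₁]
    ext a
    constructor
    · intro h
      obtain ⟨h, haM⟩ := mem_inter.1 h
      obtain ⟨-, h⟩ := mem_sdiff.1 h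
      rw [mem_union, not_or] at h
      by_contra hayb
      exact h.2 (mem_sdiff.2 ⟨haM, hayb⟩)
    · intro h
      have haM : a ∈ cM r G := hybM h
      refine mem_inter.2 ⟨mem_sdiff.2 ⟨mem_union_right _ haM, ?_⟩, haM⟩
      rw [mem_union, not_or]
      exact ⟨fun h' => disjoint_right.1 disjoint_cN_cM haM (mem_sdiff.1 h').1,
        fun h' => (mem_sdiff.1 h').2 h⟩
  -- `u₁ ∉ P`: Case II
  have hu₁P : u.erase r ∉ proj r G := by
    intro h
    rw [proj_eq_union, mem_union] at h
    rcases h with h | h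
    · have h1 : u.erase r ∈ G := (mem_part0.1 h).1
      have h2 := hR.hvalid _ (mem_partr.1 hū).2
      have e : univ \ insert r (univ \ u) = u.erase r := by
        ext a
        simp only [mem_sdiff, mem_univ, true_and, mem_insert, not_or, not_not, mem_erase, ne_eq]
      rw [e] at h2
      exact h2 h1
    · have := (mem_partr.1 h).2
      rw [insert_erase hru] at this
      exact hR.hu this
  -- (4): `(xb, M)` is partnerless
  have hk : xb ∪ cM r G ∉ partner r G := by
    intro hk
    have hkr : xb ∪ cM r G ∈ partr r G := inter_subset_right hk
    have hkG : insert r (xb ∪ cM r G) ∈ G := (mem_partr.1 hkr).2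
    have hrk : r ∉ xb ∪ cM r G := r_notMem_union hr hxb (Subset.refl _)
    rcases hR.hsig _ hkG with hA | hC'
    · refine hnotA _ hkr ?_ hA
      intro a ha
      obtain ⟨haM, hayb⟩ := mem_sdiff.1 ha
      refine mem_sdiff.2 ⟨mem_union_right _ haM, fun h => hayb ?_⟩
      exact mem_inter.2 ⟨h, haM⟩
    · obtain ⟨h1, h2⟩ := mem_diffsX_of_cells_compl hru hrk hC'
      rw [mem_diffsX_iff_coords htw hF hE hU hcore hsupp hP hC] at h1 h2
      obtain ⟨-, -, h1⟩ := h1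
      obtain ⟨-, h2, -⟩ := h2
      -- `M ∖ yb ∈ U` and `N ∖ xb ∈ L`: `u₁ ∈ P`
      apply hu₁P
      rw [hu₁]
      have e2 : (u.erase r \ (xb ∪ cM r G)) \ cM r G = cN r G \ xb := by
        rw [hu₁]
        ext a
        constructor
        · intro h
          obtain ⟨h, haM⟩ := mem_sdiff.1 h
          rcases mem_union.1 (mem_sdiff.1 h).1 with h' | h'
          · exact h'
          · exact absurd (mem_sdiff.1 h').1 haM
        · intro h
          obtain ⟨haN, haxb⟩ := mem_sdiff.1 h
          have haM : a ∉ cM r G := disjoint_left.1 disjoint_cN_cM haN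
          refine mem_sdiff.2 ⟨mem_sdiff.2 ⟨mem_union_left _ h, ?_⟩, haM⟩
          rw [mem_union, not_or]
          exact ⟨haxb, haM⟩
      rw [hinteryb] at h1
      rw [e2] at h2
      refine union_mem_proj htw hcore hC h2 ?_
      rw [mem_complWithin_iff (fun _ hy => subset_cM_of_mem_cU hy) hybM] at h1
      exact h1
  have hkP : xb ∪ cM r G ∈ part0 r G := union_mem_part0 htw hcore hC hxb (cM_mem_cU0 hcore)
  have hkrow : (xb ∪ cM r G) \ cM r G = xb := union_sdiff_cM_eq hxb (Subset.refl _)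
  -- every row `x ≠ xb` is full
  have hfull : ∀ x ∈ cL r G, x ≠ xb → ∀ y ∈ cU0 r G, x ∪ y ∈ partner r G := by
    intro x hx hxxb y hy
    refine union_mem_partner_of_ne htw hF hE hU hcore hsupp hP hC hrem hkP hk hx ?_ hy
    rwa [hkrow]
  by_cases hii : cM r G \ yb ∈ cU r G
  · -- case (i): `N ∖ xb ∉ L`
    have hi : cN r G \ xb ∉ cL r G := by
      intro h
      apply hu₁P
      rw [hu₁]
      exact union_mem_proj htw hcore hC h hii
    by_cases hxbe : xb = ∅
    · -- `xb = ∅`: the co-singleton member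
      have hybne : yb.Nonempty := by
        rw [nonempty_iff_ne_empty]
        intro hybe
        have hūe : univ \ u = ∅ := by
          rw [← sdiff_union_inter (univ \ u) (cM r G), ← hxbdef, ← hybdef, hxbe, hybe, union_empty]
        have := (mem_partr.1 hū).2
        rw [hūe, insert_empty] at this
        exact hr1 this
      obtain ⟨e, he⟩ := hybne
      have heM : e ∈ cM r G := hybM he
      have ht : cM r G \ {e} ∈ cU r G := cM_sdiff_singleton_mem_cU htw hcore heM
      -- the fibre of row `∅` is all of `M − U₀`, so `U₀ ∖ K^∅ = {M}`
      obtain ⟨x, hx, hxne⟩ := exists_nonempty_mem_cL htw hcore hsupp hC hS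
      have hxxb : x ≠ xb := by rw [hxbe]; exact hxne
      have hxM : x ∪ cM r G ∈ partner r G := hfull x hx hxxb _ (cM_mem_cU0 hcore)
      have hfib : fibre (cM r G) (diffsY r G) ∅ = complWithin (cM r G) (cU0 r G) :=
        Subset.antisymm (fibre_diffsY_subset_complWithin htw hcore hC ∅)
          (complWithin_subset_fibre_of_subset htw hF hE hU hcore hsupp hC hx (empty_subset x) hxM)
      have hexc := card_fibre_diffsY_eq_add_one htw hF hE hU hcore hsupp hP hC hrem hkP hk
      rw [hkrow, hxbe, hfib, card_complWithin (fun _ hy => subset_cM_of_mem_cU0 hy)] at hexc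
      have hK0 : fibre (cM r G) (partner r G) ∅ ⊆ cU0 r G :=
        fibre_partner_subset_cU0 htw hcore hC (empty_mem_cL hcore)
      have hMK : cM r G ∉ fibre (cM r G) (partner r G) ∅ := by
        intro h
        apply hk
        rw [hxbe]
        exact (mem_fibre.1 h).2
      have hcard : (cU0 r G \ fibre (cM r G) (partner r G) ∅).card = 1 := by
        rw [card_sdiff_of_subset hK0]
        omega
      have hsing : cU0 r G \ fibre (cM r G) (partner r G) ∅ = {cM r G} := by
        rw [card_eq_one] at hcard
        obtain ⟨a, ha⟩ := hcard
        have : cM r G ∈ cU0 r G \ fibre (cM r G) (partner r G) ∅ :=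
          mem_sdiff.2 ⟨cM_mem_cU0 hcore, hMK⟩
        rw [ha, mem_singleton] at this
        rw [ha, this]
      -- every `y ∈ U`, `y ≠ M`, is an `r`-member column of row `∅`
      have hcol : ∀ y ∈ cU r G, y ≠ cM r G → y ∈ partr r G := by
        intro y hy hyM
        by_cases hy0 : y ∈ cU0 r G
        · have : y ∈ fibre (cM r G) (partner r G) ∅ := by
            by_contra h
            have : y ∈ cU0 r G \ fibre (cM r G) (partner r G) ∅ := mem_sdiff.2 ⟨hy0, h⟩
            rw [hsing, mem_singleton] at this
            exact hyM this
          have := inter_subset_right (mem_fibre.1 this).2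
          rwa [empty_union] at this
        · have := union_mem_partr_of_mem_sdiff htw hcore hC (empty_mem_cL hcore)
            (mem_sdiff.2 ⟨hy, hy0⟩)
          rwa [empty_union] at this
      have htr : cM r G \ {e} ∈ partr r G := by
        refine hcol _ ht fun h => ?_
        have : e ∈ cM r G \ {e} := by rw [h]; exact heM
        exact (mem_sdiff.1 this).2 (mem_singleton_self e)
      have hrt : r ∉ cM r G \ {e} := fun h => r_notMem_cM (mem_sdiff.1 h).1
      rcases hR.hsig _ (mem_partr.1 htr).2 with hA | hC'
      · refine hnotA _ htr ?_ hA
        intro a ha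
        obtain ⟨haM, hayb⟩ := mem_sdiff.1 ha
        refine mem_sdiff.2 ⟨mem_sdiff.2 ⟨haM, fun h => hayb (mem_singleton.1 h ▸ he)⟩, fun h => ?_⟩
        exact hayb (mem_inter.2 ⟨h, haM⟩)
      · obtain ⟨-, h2⟩ := mem_diffsX_of_cells_compl hru hrt hC'
        rw [mem_diffsX_iff_coords htw hF hE hU hcore hsupp hP hC] at h2
        obtain ⟨-, h2, -⟩ := h2
        -- `u₁ ∖ (M ∖ e) = N`, so `N ∈ L` and `univ.erase r ∈ P`
        have e3 : (u.erase r \ (cM r G \ {e})) \ cM r G = cN r G := by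
          rw [hu₁, hxbe, sdiff_empty]
          ext a
          constructor
          · intro h
            obtain ⟨h, haM⟩ := mem_sdiff.1 h
            rcases mem_union.1 (mem_sdiff.1 h).1 with h' | h'
            · exact h'
            · exact absurd (mem_sdiff.1 h').1 haM
          · intro haN
            have haM : a ∉ cM r G := disjoint_left.1 disjoint_cN_cM haN
            exact mem_sdiff.2 ⟨mem_sdiff.2 ⟨mem_union_left _ haN, fun h => haM (mem_sdiff.1 h).1⟩,
              haM⟩
        rw [e3] at h2
        have hP' : cN r G ∪ cM r G ∈ proj r G :=
          union_mem_proj htw hcore hC h2 (cU0_subset_cU htw hcore hC (cM_mem_cU0 hcore))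
        have e4 : cN r G ∪ cM r G = univ.erase r := by
          ext a
          rw [mem_union, mem_erase, and_iff_left (mem_univ a)]
          constructor
          · rintro (h | h)
            · exact fun har => r_notMem_cN hr (har ▸ h)
            · exact fun har => r_notMem_cM (har ▸ h)
          · intro har
            rcases eq_or_mem_cN_or_mem_cM a with h | h | h
            · exact absurd h har
            · exact Or.inl h
            · exact Or.inr h
        rw [e4] at hP'
        obtain ⟨B, hB, hBe⟩ := mem_proj.1 hP'
        rcases (em (r ∈ B)) with hrB | hrB
        · have : B = univ := by
            rw [← insert_erase hrB, hBe, insert_erase (mem_univ r)]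
          exact hU (this ▸ hB)
        · rw [erase_eq_of_notMem hrB] at hBe
          exact hS (hBe ▸ hB)
    · -- `xb ≠ ∅`: the member `(∅, M)`
      have hM : (∅ : Finset α) ∪ cM r G ∈ partner r G :=
        hfull ∅ (empty_mem_cL hcore) (Ne.symm hxbe) _ (cM_mem_cU0 hcore)
      rw [empty_union] at hM
      have hMr : cM r G ∈ partr r G := inter_subset_right hM
      rcases hR.hsig _ (mem_partr.1 hMr).2 with hA | hC'
      · refine hnotA _ hMr ?_ hA
        intro a ha
        obtain ⟨haM, hayb⟩ := mem_sdiff.1 ha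
        exact mem_sdiff.2 ⟨haM, fun h => hayb (mem_inter.2 ⟨h, haM⟩)⟩
      · obtain ⟨-, h2⟩ := mem_diffsX_of_cells_compl hru r_notMem_cM hC'
        rw [mem_diffsX_iff_coords htw hF hE hU hcore hsupp hP hC] at h2
        obtain ⟨-, h2, -⟩ := h2
        apply hi
        have e5 : (u.erase r \ cM r G) \ cM r G = cN r G \ xb := by
          rw [hu₁]
          ext a
          constructor
          · intro h
            obtain ⟨h, haM⟩ := mem_sdiff.1 h
            rcases mem_union.1 (mem_sdiff.1 h).1 with h' | h'
            · exact h'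
            · exact absurd (mem_sdiff.1 h').1 haM
          · intro h
            have haM : a ∉ cM r G := disjoint_left.1 disjoint_cN_cM (mem_sdiff.1 h).1
            exact mem_sdiff.2 ⟨mem_sdiff.2 ⟨mem_union_left _ h, haM⟩, haM⟩
        rwa [e5] at h2
  · -- case (ii): `M ∖ yb ∉ U`; a full row `x ≠ xb`
    obtain ⟨x, hx, hxxb⟩ : ∃ x ∈ cL r G, x ≠ xb := by
      by_cases hxbe : xb = ∅
      · obtain ⟨x, hx, hxne⟩ := exists_nonempty_mem_cL htw hcore hsupp hC hS
        exact ⟨x, hx, by rw [hxbe]; exact hxne⟩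
      · exact ⟨∅, empty_mem_cL hcore, Ne.symm hxbe⟩
    have hxM : x ∪ cM r G ∈ partner r G := hfull x hx hxxb _ (cM_mem_cU0 hcore)
    have hxMr : x ∪ cM r G ∈ partr r G := inter_subset_right hxM
    have hrx : r ∉ x ∪ cM r G := r_notMem_union hr hx (Subset.refl _)
    rcases hR.hsig _ (mem_partr.1 hxMr).2 with hA | hC'
    · refine hnotA _ hxMr ?_ hA
      intro a ha
      obtain ⟨haM, hayb⟩ := mem_sdiff.1 ha
      exact mem_sdiff.2 ⟨mem_union_right _ haM, fun h => hayb (mem_inter.2 ⟨h, haM⟩)⟩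
    · obtain ⟨h1, -⟩ := mem_diffsX_of_cells_compl hru hrx hC'
      rw [mem_diffsX_iff_coords htw hF hE hU hcore hsupp hP hC] at h1
      obtain ⟨-, -, h1⟩ := h1
      apply hii
      rw [hinteryb, mem_complWithin_iff (fun _ hy => subset_cM_of_mem_cU hy) hybM] at h1
      exact h1

end CaseII

end PercRepro.MSTight
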